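import Summits.ValiantsHypothesis.ValiantsHypothesis.Theorems.LacunarySymmetroidMatrixDescartesFiniteSectorRowOne
import Summits.ValiantsHypothesis.ValiantsHypothesis.Theorems.LacunarySymmetroidMatrixDescartesFiniteSectorEtaThreeThree
import Summits.ValiantsHypothesis.ValiantsHypothesis.Theorems.LacunarySymmetroidMatrixDescartesFiniteSectorSectorCeilingMTwoKThreeFour

/-!
# `MatrixDescartes` — line «finite»: the small rows of the `K = 3` SECTOR column EXACT BY NAME, `η(1,3) = 5`, `η(2,3) = 8`, `η(3,3) = 14`

HONEST FRAMING.  Object-search cell `pub-symmetroid`, seat val-sym-eng-3 g10.  HELPER of the crux item `stmt-ValiantsHypothesis-18050`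
(`Theses.LacunarySymmetroid.MatrixDescartes`, asymptotic in `K`) with NO closure claim.  Pure bookkeeping, companion of
`…FiniteSectorNuKThreeSmall` (the stamp rows `ν(m,3)`, `m ≤ 5`): the sector column `η(m,3)` is in the tree by name for `m = 4, …, 11`
(`eta_four_three_exact`, …, `eta_eleven_three_exact`); this file names the three missing small rows in the same `ceiling ∧ ¬(ceiling − 1)` shape,
CITING the tree's ceilings and floors: `η(1,3) = 5` (the first row `eta_one_row_exact` of `…FiniteSectorRowOne` at `K = 3` — NOT `2·ν(1,3) = 4`:
the zero root), `η(2,3) = 8` (`hypRootLawAt_two_three_8` of `…SectorCeilingMTwoKThreeFour`, floor `eta_two_row_lower`), `η(3,3) = 14`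
(`hypRootLawAt_three_three_14`, `not_hypRootLawAt_three_three_13` of `…EtaThreeThree`).  Nothing here bears on the crux or on `VP ≠ VNP`.
[folklore] Elementary bookkeeping; no citation is load-bearing.
-/

-- `Summit.ValiantsHypothesis.ValiantsHypothesis.…` repeats a component by the D-0017 layout
-- (single-conjunct summit), which the `dupNamespace` linter flags; the name is mandated.
set_option linter.dupNamespace false

namespace Summit.ValiantsHypothesis.ValiantsHypothesis.Theorems.LacunarySymmetroidMatrixDescartes.FiniteSector

/-- **`η(1,3) = 5` EXACT**: `HypRootLawAt 1 3 5 ∧ ¬ HypRootLawAt 1 3 4` (the first row at `K = 3`: a trinomial has at most five distinct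
real zeros, `t⁵ − 5t³ + 4t = t(t²−1)(t²−4)` has five). [folklore] -/
theorem eta_one_three_exact : HypRootLawAt 1 3 5 ∧ ¬ HypRootLawAt 1 3 4 :=
  eta_one_row_exact 3 (by norm_num)

/-- **`η(2,3) = 8` EXACT**: `HypRootLawAt 2 3 8 ∧ ¬ HypRootLawAt 2 3 7` (ceiling `hypRootLawAt_two_three_8`; floor = the doubled stamp row
`ν(2,3) = 4`, `eta_two_row_lower`). [folklore] -/
theorem eta_two_three_exact : HypRootLawAt 2 3 8 ∧ ¬ HypRootLawAt 2 3 7 :=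
  ⟨hypRootLawAt_two_three_8, eta_two_row_lower.1⟩

/-- **`η(3,3) = 14` EXACT**: `HypRootLawAt 3 3 14 ∧ ¬ HypRootLawAt 3 3 13` (`hypRootLawAt_three_three_14`, `not_hypRootLawAt_three_three_13`).
[folklore] -/
theorem eta_three_three_exact : HypRootLawAt 3 3 14 ∧ ¬ HypRootLawAt 3 3 13 :=
  ⟨hypRootLawAt_three_three_14, not_hypRootLawAt_three_three_13⟩

/-- The `K = 3` sector column for `m ≤ 3` in one line: `η(1,3) = 5`, `η(2,3) = 8`, `η(3,3) = 14`. [folklore] -/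
theorem eta_K_three_small_exact :
    (HypRootLawAt 1 3 5 ∧ ¬ HypRootLawAt 1 3 4) ∧ (HypRootLawAt 2 3 8 ∧ ¬ HypRootLawAt 2 3 7) ∧
      (HypRootLawAt 3 3 14 ∧ ¬ HypRootLawAt 3 3 13) :=
  ⟨eta_one_three_exact, eta_two_three_exact, eta_three_three_exact⟩

end Summit.ValiantsHypothesis.ValiantsHypothesis.Theorems.LacunarySymmetroidMatrixDescartes.FiniteSector
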